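import Summits.HodgeConjecture.HodgeConjecture.Theorems.MarkmanPartnerTransportPicardThreeK3SquaresZeta9TypePicardTen
import Summits.HodgeConjecture.HodgeConjecture.Theorems.MarkmanPartnerTransportPicardThreeK3SquaresSqrt2TypePicardTen
import HarnessLib

/-!
# Route MarkmanPartnerTransport · crux `PicardThreeK3Squares` (stmt-HodgeConjecture-19652) —
# the √2 type FORCES Picard number 10: HC⁴(S ⊗ S) from the conjugacy and the generation clause

Cell hodge-nonav, crux #4, INDEX row M-θ√2 (prover seat hodge-nonav-19652-p1 gen 12; `--supports
stmt-HodgeConjecture-19652`, helper). The √2 companion of `…Zeta9TypeOfConj` (independent of it), with one GENERIC lemma: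
* **`exists_mem_algebraicClasses_of_ratCast_mem_ker_of_ne_zero`** (any `k3Form`-self-adjoint rational
  model `θ`) — for a marked projective K3 surface `(S, η, p, x)` whose endomorphism `t` (type-preserving) is
  conjugate by a rational isometry `σ` of `Λ_ℚ` to `θ_ℂ` and whose `(2,0)`-eigenvalue is NON-ZERO, every
  rational vector of `ker θ_ℂ` is `ση(d)` for an algebraic divisor class `d` (rational; `(1,1)` by
  self-adjointness and reality of `σ`; Lefschetz `(1,1)`).
* `eigenvalue_ne_zero_of_sqrt2Model` — for a √2 datum (`θ` self-adjoint, `dim ker θ_ℂ = 10`, `θ³ = 2θ`)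
  the `(2,0)`-eigenvalue of `t` is non-zero: otherwise the self-adjoint rational projector `P_T = ½θ²`
  sends every rational vector into `(σx)^⊥`, where `θ` vanishes by `θ`-genericity, so `θ = θ ∘ P_T = 0`,
  contradicting `dim ker θ_ℂ = 10 < 22`.
* `ker_thetaC_le_span_ratCast_of_sqrt2Model` — `ker θ_ℂ = im(1 - ½θ²)` is spanned by rational vectors.
* **`finrank_algebraicClasses_eq_ten_of_sqrt2Model`** — hence `ρ(S) = 10` for every K3 surface of the type.
* **`exists_sqrt2Type_hodgeConjectureFor_square_of_conj`** — ∃ √2 datum such that EVERY marked projective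
  K3 surface with an endomorphism `t` (rational, type-preserving, killing `N¹`, image `⊥ N¹`, GENERATING
  `End_Hdg T(S)`) conjugate by a rational isometry to `θ_ℂ` has `HodgeConjectureFor 4 (S ⊗ S)` — no Picard
  number and no annihilating polynomial among the hypotheses (generation stays: `12 = 2·2·3`). CONDITIONAL on
  {`Buskin2019_hodgeIsometry_algebraic`, `VanGeemenSchuett2025_sqrt2_cycleOnOpenPeriodSet`}; credits
  nothing; HC is NOT proved here.

No definition, no sorry. References: van Geemen–Schütt, Forum Math. Sigma 13 (2025) e2, Thm. 1.2 (2),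
Prop. 6.2, §6.4, Rem. 6.5, §2.1; Huybrechts, *Lectures on K3 Surfaces*, Ch. 1 Prop. 3.5, Ch. 3 §3.2;
Buskin, J. reine angew. Math. 755 (2019), Thm. 1.1 and §6.2.
-/

set_option linter.dupNamespace false

noncomputable section

namespace Summit.HodgeConjecture.HodgeConjecture.Theorems.MarkmanPartnerTransport.RMTypeOrbit

open CategoryTheory MonoidalCategory Polynomial
open Literature.AlgebraicGeometry Literature.AlgebraicGeometry.Motives Literature.AlgebraicGeometry.HodgeTheory
open Literature.AlgebraicGeometry.Surfaces Literature.LinearAlgebra.QuadraticForm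
open Literature.AlgebraicTopology.SingularHomology
open Summit.HodgeConjecture.HodgeConjecture.Theorems.NikulinTwinTransport
open Summit.HodgeConjecture.HodgeConjecture.Theorems.MarkmanPartnerTransport.IsogenyInvariance
open Summit.HodgeConjecture.HodgeConjecture.Theorems.MarkmanPartnerTransport.RMTypeDescent

/-- `MarkedK3[S, η, p, x]`: VERBATIM the `let MarkedK3 := …` binder of the route declaration
`PicardThreeK3Squares` (as in `…RMTypeDescent`). Local notation only. -/
local notation3 (prettyPrint := false) "MarkedK3[" S ", " η ", " p ", " x "]" =>
  (p ≠ 0 ∧ (IsIntegralClass p ∧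
    (∀ q : complexBetti S (2 * 2), IsIntegralClass q → ∃ n : ℤ, q = n • p) ∧
    (∀ c : complexBetti S (2 * 1), IsIntegralClass c ↔ ∃ v : K3Index → ℤ, η c = fun i => (v i : ℂ)) ∧
    (∀ a b : complexBetti S (2 * 1),
      cupProduct (rfl : 2 * 1 + 2 * 1 = 2 * 2) a b = k3Form (η a) (η b) • p) ∧
    IsOfHodgeType 2 S (2 * 1) 2 0 (LinearEquiv.symm η x) ∧
    (∀ τ : complexBetti S (2 * 1), IsOfHodgeType 2 S (2 * 1) 2 0 τ →
      ∃ t : ℂ, τ = t • LinearEquiv.symm η x)) ∧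
    (k3Form x x = 0 ∧ 0 < (k3Form (star x) x).re ∧
      ∃ u : K3Index → ℤ, k3Form (fun i => (u i : ℂ)) x = 0 ∧ 0 < ∑ i, ∑ j, u i * k3Gram i j * u j))

/-- `Sqrt2Model[θ]`: VERBATIM the datum conjuncts of the named fact
`VanGeemenSchuett2025_sqrt2_cycleOnOpenPeriodSet` (as in `…Sqrt2Type`). Local notation only. -/
local notation3 (prettyPrint := false) "Sqrt2Model[" θ "]" =>
  ((∀ a b : K3Index → ℂ, k3Form (thetaC θ a) b = k3Form a (thetaC θ b)) ∧
    Module.finrank ℂ (LinearMap.ker (thetaC θ)) = 10 ∧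
    thetaC θ ^ 3 = (2 : ℂ) • thetaC θ)

variable {θ : Matrix K3Index K3Index ℚ} {S : SchemeOver ℂ}

/-- **Every rational vector of `ker θ_ℂ` is the image of an algebraic divisor class (generic `θ`).** For a
`k3Form`-self-adjoint rational model `θ`, a marked projective K3 surface `(S, η, p, x)`, an endomorphism
`t` with `t(η⁻¹x) = ev·η⁻¹x`, `ev ≠ 0`, conjugate by a rational isometry `σ` to `θ_ℂ`, and a rational
`q ∈ ker θ_ℂ`: `q = ση(d)` with `d ∈ N¹(S)`. `d = η⁻¹σ⁻¹q` is rational; `(ηd . x) = (q . σx) =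
ev⁻¹(θq . σx) = 0` and `(ηd . x̄) = (q . σx̄) = 0` (`σ` real, a product of lattice reflections), so `d` is
of type `(1,1)` and algebraic by Lefschetz `(1,1)`. Fact-free.
[cite: Huybrechts2016K3, Ch. 1 Prop. 3.5 and Ch. 3 §3.2] [cite: Buskin2019, §6.2] -/
theorem exists_mem_algebraicClasses_of_ratCast_mem_ker_of_ne_zero
    (hθsa : ∀ a b : K3Index → ℂ, k3Form (thetaC θ a) b = k3Form a (thetaC θ b)) (hS : IsK3Surface S)
    (η : complexBetti S (2 * 1) ≃ₗ[ℂ] (K3Index → ℂ)) (p : complexBetti S (2 * 2)) (x : K3Index → ℂ)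
    (hM : MarkedK3[S, η, p, x])
    (t : complexBetti S (2 * 1) →ₗ[ℂ] complexBetti S (2 * 1))
    (σ : Module.End ℂ (K3Index → ℂ)) (hσ : ∀ a b, k3Form (σ a) (σ b) = k3Form a b)
    (hσrat : ∀ v : K3Index → ℤ, ∃ w : K3Index → ℚ, σ (fun i => (v i : ℂ)) = fun i => (w i : ℂ))
    (hconj : ∀ c : complexBetti S (2 * 1), σ (η (t c)) = thetaC θ (σ (η c)))
    {ev : ℂ} (hev : t (η.symm x) = ev • η.symm x) (hev0 : ev ≠ 0)
    (q : K3Index → ℚ) (hq : thetaC θ (fun i => (q i : ℂ)) = 0) :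
    ∃ d ∈ algebraicClasses S 1, σ (η d) = fun i => (q i : ℂ) := by
  classical
  have hHT : Huybrechts_K3_hodgeTypes_H2 := Huybrechts_K3_hodgeTypes_H2_holds
  obtain ⟨hp0, ⟨hpint, hpgen, hηint, hηcup, h20, hline⟩, hPer⟩ := hM
  have hx0 : η.symm x ≠ 0 := fun h0 =>
    ne_zero_of_star_self_re_pos hPer.2.1 (by simpa using congrArg η h0)
  have heig : thetaC θ (σ x) = ev • σ x := by
    have h := hconj (η.symm x)
    rw [hev, map_smul, LinearEquiv.apply_symm_apply, map_smul] at h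
    exact h.symm
  obtain ⟨σ', hσσ', -, -, hσ'rat⟩ := exists_inverse_ratIsometry σ hσ hσrat
  set qC : K3Index → ℂ := fun i => (q i : ℂ) with hqC
  set d : complexBetti S (2 * 1) := η.symm (σ' qC) with hd
  have hAd : σ (η d) = qC := by rw [hd, LinearEquiv.apply_symm_apply, hσσ']
  have hd_rat : IsRationalClass d := by
    obtain ⟨w, hw⟩ := ratEnd_ratCast σ' hσ'rat q
    exact (isRationalClass_iff_of_marking hS η hηint d).2 ⟨w, by rw [hd, LinearEquiv.apply_symm_apply, hw]⟩
  have horth : k3Form qC (σ x) = 0 := by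
    have h := hθsa qC (σ x)
    rw [hq, k3Form_zero_left, heig, k3Form_smul_right] at h
    exact (mul_eq_zero.1 h.symm).resolve_left hev0
  have horth' : k3Form qC (star (σ x)) = 0 := by
    have h := hθsa qC (star (σ x))
    rw [hq, k3Form_zero_left, thetaC_star, heig, star_smul, k3Form_smul_right] at h
    exact (mul_eq_zero.1 h.symm).resolve_left (star_ne_zero.2 hev0)
  -- `σ` is real (a product of reflections along lattice vectors)
  have hσstar : star (σ x) = σ (star x) := by
    obtain ⟨l, -, -, hl⟩ := exists_eq_prod_k3ReflectionC σ hσ hσrat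
    have key : ∀ (l : List (K3Index → ℤ)) (y : K3Index → ℂ),
        star ((l.map k3ReflectionC).prod y) = (l.map k3ReflectionC).prod (star y) := by
      intro l
      induction l with
      | nil => intro y; simp
      | cons v l ih =>
        intro y
        rw [List.map_cons, List.prod_cons, Module.End.mul_apply, Module.End.mul_apply, star_k3ReflectionC, ih]
    rw [hl]
    exact key l x
  obtain ⟨-, -, h3⟩ := hHT S hS (η.symm x) h20 hx0
  have hcup1 : cupProduct (rfl : 2 * 1 + 2 * 1 = 2 * 2) d (η.symm x) = 0 := by
    rw [hηcup, hd, LinearEquiv.apply_symm_apply, LinearEquiv.apply_symm_apply, ← hσ (σ' qC) x, hσσ', horth,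
      zero_smul]
  have hcup2 :
      cupProduct (rfl : 2 * 1 + 2 * 1 = 2 * 2) d (conjClass (ComplexPoints S) (2 * 1) (η.symm x)) = 0 := by
    rw [conjClass_marking_symm η hηint x, hηcup, hd, LinearEquiv.apply_symm_apply,
      LinearEquiv.apply_symm_apply, ← hσ (σ' qC) (star x), hσσ', ← hσstar, horth', zero_smul]
  have h11 : IsOfHodgeType 2 S (2 * 1) 1 1 d := (h3 d).2 ⟨hcup1, hcup2⟩
  exact ⟨d, lefschetzOneOne_rational_holds hS.1 d hd_rat h11, hAd⟩

/-- `θ_ℂ = θ_ℂ ∘ (½θ_ℂ²)` for a √2 datum (`θ³ = 2θ`). [folklore] -/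
theorem thetaC_eq_mul_proj_of_sqrt2Model (hZ : Sqrt2Model[θ]) :
    thetaC θ = thetaC θ * ((1 / 2 : ℂ) • thetaC θ ^ 2) := by
  rw [mul_smul_comm, ← pow_succ', hZ.2.2, smul_smul]
  norm_num

/-- `½θ_ℂ²` maps rational vectors to rational vectors. [folklore] -/
theorem sqrt2_proj_ratCast (θ : Matrix K3Index K3Index ℚ) (v : K3Index → ℚ) :
    ((1 / 2 : ℂ) • thetaC θ ^ 2) (fun i => (v i : ℂ)) =
      fun i => (((1 / 2 : ℚ) • θ.mulVec (θ.mulVec v)) i : ℂ) := by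
  rw [LinearMap.smul_apply, pow_two, Module.End.mul_apply, thetaC_ratCast, thetaC_ratCast]
  funext i
  simp only [Pi.smul_apply, smul_eq_mul, Rat.cast_mul, Rat.cast_div, Rat.cast_one, Rat.cast_ofNat]

/-- **The `(2,0)`-eigenvalue of an endomorphism conjugate to a √2 model is non-zero.** Otherwise
`σx ∈ ker θ_ℂ`, the self-adjoint rational projector `½θ²` sends every rational vector into `(σx)^⊥`, where
`θ` vanishes by the `θ`-genericity of `σx` (`generic_and_posKernel_of_marking`), so `θ = θ ∘ ½θ² = 0` —
contradicting `dim ker θ_ℂ = 10 < 22`. Fact-free. [cite: GeemenSchutt2023, §2.1 and §6.4]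
[cite: Huybrechts2016K3, Ch. 3 §3.2] -/
theorem eigenvalue_ne_zero_of_sqrt2Model (hZ : Sqrt2Model[θ]) (hS : IsK3Surface S)
    (η : complexBetti S (2 * 1) ≃ₗ[ℂ] (K3Index → ℂ)) (p : complexBetti S (2 * 2)) (x : K3Index → ℂ)
    (hM : MarkedK3[S, η, p, x])
    (t : complexBetti S (2 * 1) →ₗ[ℂ] complexBetti S (2 * 1))
    (ht_N : ∀ d ∈ algebraicClasses S 1, t d = 0)
    (σ : Module.End ℂ (K3Index → ℂ)) (hσ : ∀ a b, k3Form (σ a) (σ b) = k3Form a b)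
    (hσrat : ∀ v : K3Index → ℤ, ∃ w : K3Index → ℚ, σ (fun i => (v i : ℂ)) = fun i => (w i : ℂ))
    (hconj : ∀ c : complexBetti S (2 * 1), σ (η (t c)) = thetaC θ (σ (η c)))
    {ev : ℂ} (hev : t (η.symm x) = ev • η.symm x) : ev ≠ 0 := by
  classical
  obtain ⟨hθsa, hfin, hcube⟩ := hZ
  intro hev0
  obtain ⟨hgenσ, -⟩ := generic_and_posKernel_of_marking hS η p x hM t ht_N σ hσ hσrat hconj
  have hθσx : thetaC θ (σ x) = 0 := by
    have h := hconj (η.symm x)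
    rw [hev, hev0, zero_smul, map_zero, map_zero, LinearEquiv.apply_symm_apply] at h
    exact h.symm
  set P : Module.End ℂ (K3Index → ℂ) := (1 / 2 : ℂ) • thetaC θ ^ 2 with hP
  have hPsa : ∀ a b : K3Index → ℂ, k3Form (P a) b = k3Form a (P b) := by
    intro a b
    simp only [hP, LinearMap.smul_apply, k3Form_smul_left, k3Form_smul_right, k3Form_pow_selfAdjoint hθsa]
  have hPσx : P (σ x) = 0 := by
    rw [hP, LinearMap.smul_apply, pow_two, Module.End.mul_apply, hθσx, map_zero, smul_zero]
  have hθP : ∀ v : K3Index → ℚ, thetaC θ (P (fun i => (v i : ℂ))) = 0 := by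
    intro v
    rw [hP, sqrt2_proj_ratCast θ v, thetaC_ratCast]
    have h0 : θ.mulVec ((1 / 2 : ℚ) • θ.mulVec (θ.mulVec v)) = 0 := by
      refine hgenσ _ ?_
      rw [← sqrt2_proj_ratCast θ v, ← hP, hPsa, hPσx, k3Form_zero_right]
    rw [h0]
    funext i
    simp
  have hθ0 : thetaC θ = 0 := by
    rw [thetaC_eq_mul_proj_of_sqrt2Model ⟨hθsa, hfin, hcube⟩, ← hP]
    refine (Pi.basisFun ℂ K3Index).ext fun i => ?_
    rw [Module.End.mul_apply, LinearMap.zero_apply, Pi.basisFun_apply]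
    have h := hθP (Pi.single i 1)
    have hcast : (fun j => ((Pi.single i (1 : ℚ) : K3Index → ℚ) j : ℂ)) = Pi.single i (1 : ℂ) := by
      funext j
      by_cases hij : j = i
      · subst hij; simp
      · simp [hij]
    rw [hcast] at h
    exact h
  -- contradiction: `ker 0 = ⊤` has dimension `22 ≠ 10`
  rw [hθ0, LinearMap.ker_zero, finrank_top, Module.finrank_fintype_fun_eq_card] at hfin
  exact absurd hfin (by decide)

/-- **`ker θ_ℂ` is spanned by rational vectors** (√2 datum): `ker θ_ℂ` is the image of the rational
operator `1 - ½θ²` (`θ(1 - ½θ²) = θ - ½θ³ = 0`; `(1 - ½θ²)w = w` on `ker θ`). [folklore] -/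
theorem ker_thetaC_le_span_ratCast_of_sqrt2Model (hZ : Sqrt2Model[θ]) :
    LinearMap.ker (thetaC θ) ≤
      Submodule.span ℂ {w : K3Index → ℂ | (∃ q : K3Index → ℚ, w = fun i => (q i : ℂ)) ∧ thetaC θ w = 0} := by
  classical
  obtain ⟨-, -, hcube⟩ := hZ
  intro w hw
  rw [LinearMap.mem_ker] at hw
  set PN : Module.End ℂ (K3Index → ℂ) := 1 - (1 / 2 : ℂ) • thetaC θ ^ 2 with hPN
  have hPNw : PN w = w := by
    rw [hPN, LinearMap.sub_apply, Module.End.one_apply, LinearMap.smul_apply, pow_two, Module.End.mul_apply,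
      hw, map_zero, smul_zero, sub_zero]
  have hop : thetaC θ * PN = 0 := by
    rw [hPN, mul_sub, mul_one, mul_smul_comm, ← pow_succ', hcube, smul_smul]
    norm_num
  have hPNker : ∀ z, thetaC θ (PN z) = 0 := fun z => by
    rw [← Module.End.mul_apply, hop, LinearMap.zero_apply]
  have hPNrat : ∀ i : K3Index, ∃ q : K3Index → ℚ, PN (Pi.single i 1) = fun j => (q j : ℂ) := by
    intro i
    have hcast : (Pi.single i (1 : ℂ) : K3Index → ℂ) = fun j => ((Pi.single i (1 : ℚ) : K3Index → ℚ) j : ℂ) := by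
      funext j
      by_cases hij : j = i
      · subst hij; simp
      · simp [hij]
    refine ⟨Pi.single i (1 : ℚ) - (1 / 2 : ℚ) • θ.mulVec (θ.mulVec (Pi.single i 1)), ?_⟩
    rw [hcast, hPN, LinearMap.sub_apply, Module.End.one_apply, sqrt2_proj_ratCast]
    funext j
    simp only [Pi.sub_apply, Rat.cast_sub]
  have hdecomp : w = ∑ i, w i • PN (Pi.single i 1) := by
    conv_lhs => rw [← hPNw, ← Finset.univ_sum_single w]
    rw [map_sum]
    refine Finset.sum_congr rfl fun i _ => ?_
    rw [← map_smul]
    congr 1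
    funext j
    simp [Pi.single_apply]
  rw [hdecomp]
  refine Submodule.sum_mem _ fun i _ => Submodule.smul_mem _ _ (Submodule.subset_span ?_)
  obtain ⟨q, hq⟩ := hPNrat i
  exact ⟨⟨q, hq⟩, hPNker _⟩

/-- **A K3 surface of the van Geemen–Schütt √2 rational real-multiplication type has Picard number `10`.**
For a marked projective K3 surface with an endomorphism `t` (type-preserving, killing `N¹(S)`) conjugate by a
rational isometry `σ` of `Λ_ℚ` to a √2 model `θ_ℂ`: `ρ(S) = 10` — `ση` maps `N¹(S)_ℂ` into `ker θ_ℂ`, and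
onto (rational spanning + Lefschetz `(1,1)`), and `dim ker θ_ℂ = 10`. Fact-free.
[cite: GeemenSchutt2023, Thm. 1.2 (2) and §6.4] [cite: Huybrechts2016K3, Ch. 3 §3.2] -/
theorem finrank_algebraicClasses_eq_ten_of_sqrt2Model (hZ : Sqrt2Model[θ]) (hS : IsK3Surface S)
    (η : complexBetti S (2 * 1) ≃ₗ[ℂ] (K3Index → ℂ)) (p : complexBetti S (2 * 2)) (x : K3Index → ℂ)
    (hM : MarkedK3[S, η, p, x])
    (t : complexBetti S (2 * 1) →ₗ[ℂ] complexBetti S (2 * 1))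
    (ht_typ : ∀ (i j : ℕ) (y : complexBetti S (2 * 1)),
      IsOfHodgeType 2 S (2 * 1) i j y → IsOfHodgeType 2 S (2 * 1) i j (t y))
    (ht_N : ∀ d ∈ algebraicClasses S 1, t d = 0)
    (σ : Module.End ℂ (K3Index → ℂ)) (hσ : ∀ a b, k3Form (σ a) (σ b) = k3Form a b)
    (hσrat : ∀ v : K3Index → ℤ, ∃ w : K3Index → ℚ, σ (fun i => (v i : ℂ)) = fun i => (w i : ℂ))
    (hconj : ∀ c : complexBetti S (2 * 1), σ (η (t c)) = thetaC θ (σ (η c))) :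
    Module.finrank ℂ ↥(algebraicClasses S 1) = 10 := by
  classical
  have hθsa := hZ.1
  obtain ⟨hp0, ⟨hpint, hpgen, hηint, hηcup, h20, hline⟩, hPer⟩ := hM
  obtain ⟨ev, hev⟩ := hline (t (η.symm x)) (ht_typ 2 0 _ h20)
  have hM' : MarkedK3[S, η, p, x] := ⟨hp0, ⟨hpint, hpgen, hηint, hηcup, h20, hline⟩, hPer⟩
  have hev0 : ev ≠ 0 := eigenvalue_ne_zero_of_sqrt2Model hZ hS η p x hM' t ht_N σ hσ hσrat hconj hev
  set A : complexBetti S (2 * 1) →ₗ[ℂ] (K3Index → ℂ) := σ ∘ₗ η.toLinearMap with hA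
  have hAapp : ∀ c, A c = σ (η c) := fun c => rfl
  have hσinj : Function.Injective σ := injective_of_k3Form_isometry σ hσ
  have hAinj : Function.Injective A := fun a b hab => η.injective (hσinj hab)
  set N := algebraicClasses S 1 with hNdef
  have hle : N.map A ≤ LinearMap.ker (thetaC θ) := by
    rintro w ⟨d, hd, rfl⟩
    rw [LinearMap.mem_ker, hAapp, ← hconj, ht_N d hd, map_zero, map_zero]
  have hge : LinearMap.ker (thetaC θ) ≤ N.map A := by
    refine (ker_thetaC_le_span_ratCast_of_sqrt2Model hZ).trans (Submodule.span_le.2 ?_)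
    rintro w ⟨⟨q, rfl⟩, hq⟩
    obtain ⟨d, hd, hdq⟩ := exists_mem_algebraicClasses_of_ratCast_mem_ker_of_ne_zero hθsa hS η p x hM' t σ hσ
      hσrat hconj hev hev0 q hq
    exact ⟨d, hd, hdq⟩
  have heq : N.map A = LinearMap.ker (thetaC θ) := le_antisymm hle hge
  rw [LinearEquiv.finrank_eq (Submodule.equivMapOfInjective A hAinj N), heq]
  exact hZ.2.1

/-- **HC⁴(S ⊗ S) for every K3 surface of the van Geemen–Schütt √2 real-multiplication type, from the
conjugacy and the generation clause alone.** THERE IS a √2 datum `θ` (as supplied by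
`VanGeemenSchuett2025_sqrt2_cycleOnOpenPeriodSet`) such that EVERY projective K3 surface `S`, marked by
`(η, p, x)`, carrying an endomorphism `t` of `H²(S(ℂ); ℂ)` — rational, Hodge-type preserving, killing `N¹H²`,
image cup-orthogonal to `N¹H²`, generating `End_Hdg T(S)` — conjugate to `θ_ℂ` by a RATIONAL ISOMETRY `σ`
of `Λ_ℚ` satisfies `HodgeConjectureFor 4 (S ⊗ S)`: `ρ(S) = 10` is forced
(`finrank_algebraicClasses_eq_ten_of_sqrt2Model`) and `exists_sqrt2Type_hodgeConjectureFor_square_of_picard_ten`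
applies. CONDITIONAL on {`Buskin2019_hodgeIsometry_algebraic`, `VanGeemenSchuett2025_sqrt2_cycleOnOpenPeriodSet`};
credits nothing; HC is NOT proved here. [cite: GeemenSchutt2023, Thm. 1.2 (2), Prop. 6.2, §6.4, Rem. 6.5]
[cite: Buskin2019, Thm. 1.1] [cite: Huybrechts2016K3, Ch. 3 §3.2 and Cor. 3.6] -/
theorem exists_sqrt2Type_hodgeConjectureFor_square_of_conj
    (hB : Buskin2019_hodgeIsometry_algebraic) (hV : VanGeemenSchuett2025_sqrt2_cycleOnOpenPeriodSet) :
    ∃ θ : Matrix K3Index K3Index ℚ, Sqrt2Model[θ] ∧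
      ∀ (S : SchemeOver ℂ) (_hS : IsK3Surface S)
        (η : complexBetti S (2 * 1) ≃ₗ[ℂ] (K3Index → ℂ)) (p : complexBetti S (2 * 2)) (x : K3Index → ℂ)
        (_hM : MarkedK3[S, η, p, x])
        (t : complexBetti S (2 * 1) →ₗ[ℂ] complexBetti S (2 * 1))
        (_ht_rat : ∀ y, IsRationalClass y → IsRationalClass (t y))
        (_ht_typ : ∀ (i j : ℕ) (y : complexBetti S (2 * 1)),
          IsOfHodgeType 2 S (2 * 1) i j y → IsOfHodgeType 2 S (2 * 1) i j (t y))
        (_ht_N : ∀ d ∈ algebraicClasses S 1, t d = 0)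
        (_ht_perp : ∀ (y : complexBetti S (2 * 1)), ∀ d ∈ algebraicClasses S 1,
          cupProduct (rfl : 2 * 1 + 2 * 1 = 2 * 2) (t y) d = 0)
        (_hgen : TranscendentalEndomorphismsGeneratedBy S t)
        (σ : Module.End ℂ (K3Index → ℂ)) (_hσ : ∀ a b, k3Form (σ a) (σ b) = k3Form a b)
        (_hσrat : ∀ v : K3Index → ℤ, ∃ w : K3Index → ℚ, σ (fun i => (v i : ℂ)) = fun i => (w i : ℂ))
        (_hconj : ∀ c : complexBetti S (2 * 1), σ (η (t c)) = thetaC θ (σ (η c))),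
        HodgeConjectureFor 4 (S ⊗ S) := by
  obtain ⟨θ, hZ, h10⟩ := exists_sqrt2Type_hodgeConjectureFor_square_of_picard_ten hB hV
  refine ⟨θ, hZ, ?_⟩
  intro S hS η p x hM t ht_rat ht_typ ht_N ht_perp hgen σ hσ hσrat hconj
  exact h10 S hS (finrank_algebraicClasses_eq_ten_of_sqrt2Model hZ hS η p x hM t ht_typ ht_N σ hσ hσrat hconj)
    η p x hM t ht_rat ht_typ ht_N ht_perp hgen σ hσ hσrat hconj

end Summit.HodgeConjecture.HodgeConjecture.Theorems.MarkmanPartnerTransport.RMTypeOrbit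

end
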